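import Literature.Algebra.Homology.HomologyEulerCharacteristicShortExact
import Mathlib.Algebra.Homology.HomologicalComplexBiprod
import Mathlib.Algebra.Homology.SingleHomology
import HarnessLib

/-!
# Euler characteristics of the zero complex, of `single` complexes and of binary biproducts

Layer `Literature/Algebra/Homology` (pure linear algebra over Mathlib; proved theorems only, 0 definitions, 0 named
facts, no instances, no notation). The base cases of the Euler-characteristic calculus of
`EulerPoincareFormula` ∕ `EulerCharacteristicShortExact` ∕ `HomologyEulerCharacteristicShortExact`, for complexes of vector
spaces over a division ring `K` of ANY shape `c` with `ComplexShape.EulerCharSigns`, in Mathlib's vocabulary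
(`HomologicalComplex.eulerChar`, `homologyEulerChar`, `HomologicalComplex.single`, the biproduct `C ⊞ D` of
`Mathlib.Algebra.Homology.HomologicalComplexBiprod`):

* `eulerChar_of_isZero`, `homologyEulerChar_of_isZero` — a zero complex has `χ = χ_H = 0`;
* **`eulerChar_single : ((single _ c n).obj V).eulerChar = χ(n) · dim V`** and
  **`homologyEulerChar_single : ((single _ c n).obj V).homologyEulerChar = χ(n) · dim V`** (`isZero_single_obj_X`,
  `singleObjXSelf`, `isZero_single_obj_homology`, `singleObjHomologySelfIso`), with the supports
  `finrankSupport_single_subset` ∕ `finrankSupport_single_homology_subset` (`⊆ {n}`);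
* **`eulerChar_biprod : (C ⊞ D).eulerChar = C.eulerChar + D.eulerChar`** and
  **`homologyEulerChar_biprod : (C ⊞ D).homologyEulerChar = C.homologyEulerChar + D.homologyEulerChar`**
  (the split short exact sequence `C ⟶ C ⊞ D ⟶ D`, `ShortComplex.Splitting.ofHasBinaryBiproduct`, through
  `EulerCharShortExact.eulerChar_X₂_eq_add` ∕ `homologyEulerChar_X₂_eq_add`).

NOT this statement: the tree's `Literature.AlgebraicGeometry.KTheory.EulerCharacteristic.eulerChar_single` is the
`K₀`-class identity `χ(M[j]) = (−1)ʲ [M]` for coherent sheaves — a different object (named so that no dedup arises);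
Mathlib (pin v4.32) has no `single` ∕ `biprod` lemma for its `eulerChar` (`lean search 'eulerChar'`).

Library only (cell `pub-hodge-ring2`, count-neutral); proves nothing about any crux, route or conjecture.

## References

* S. Lang, *Algebra* (2002), Ch. XX §3 (Euler characteristic; additivity). [Lang2002]
* A. Hatcher, *Algebraic Topology* (2002), §2.2, Thm. 2.44. [HatcherAT2002]
-/

open CategoryTheory CategoryTheory.Limits

universe v u w

namespace Literature.Algebra.Homology.EulerCharSingleBiprod

variable {K : Type u} [DivisionRing K] {ι : Type w} {c : ComplexShape ι}

/-! ### The zero complex -/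

/-- A zero complex has Euler characteristic `0`. [cite: Lang2002, XX §3] -/
theorem eulerChar_of_isZero [c.EulerCharSigns] {C : HomologicalComplex (ModuleCat.{v} K) c} (hC : IsZero C) : C.eulerChar = 0 := by
  simp only [HomologicalComplex.eulerChar, GradedObject.eulerChar]
  refine finsum_eq_zero_of_forall_eq_zero fun i => ?_
  haveI : Subsingleton (C.X i) := ModuleCat.subsingleton_of_isZero ((HomologicalComplex.eval _ c i).map_isZero hC)
  rw [Module.finrank_zero_of_subsingleton, Nat.cast_zero, mul_zero]

/-- A zero complex has homological Euler characteristic `0`. [cite: Lang2002, XX §3] -/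
theorem homologyEulerChar_of_isZero [c.EulerCharSigns] {C : HomologicalComplex (ModuleCat.{v} K) c} (hC : IsZero C) :
    C.homologyEulerChar = 0 := by
  simp only [HomologicalComplex.homologyEulerChar, GradedObject.eulerChar]
  refine finsum_eq_zero_of_forall_eq_zero fun i => ?_
  haveI : Subsingleton (C.homology i) :=
    ModuleCat.subsingleton_of_isZero ((HomologicalComplex.homologyFunctor _ c i).map_isZero hC)
  rw [Module.finrank_zero_of_subsingleton, Nat.cast_zero, mul_zero]

/-! ### `single` complexes -/

section Single

variable [DecidableEq ι] (V : ModuleCat.{v} K) (n : ι)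

/-- The terms of `(single n).obj V` have rank `0` off `n`. [cite: Lang2002, XX §3] -/
theorem finrankSupport_single_subset :
    GradedObject.finrankSupport ((HomologicalComplex.single _ c n).obj V).X ⊆ ({n} : Finset ι) := by
  intro i hi
  rw [Finset.coe_singleton, Set.mem_singleton_iff]
  by_contra hin
  haveI := ModuleCat.subsingleton_of_isZero (HomologicalComplex.isZero_single_obj_X c n V i hin)
  exact hi Module.finrank_zero_of_subsingleton

/-- The homology of `(single n).obj V` has rank `0` off `n`. [cite: Lang2002, XX §3] -/
theorem finrankSupport_single_homology_subset :
    GradedObject.finrankSupport (fun i => ((HomologicalComplex.single _ c n).obj V).homology i) ⊆ ({n} : Finset ι) := by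
  intro i hi
  rw [Finset.coe_singleton, Set.mem_singleton_iff]
  by_contra hin
  haveI := ModuleCat.subsingleton_of_isZero (HomologicalComplex.isZero_single_obj_homology c n V i hin)
  exact hi Module.finrank_zero_of_subsingleton

/-- **`χ((single n).obj V) = χ(n) · dim V`**. [cite: Lang2002, XX §3] -/
theorem eulerChar_single [c.EulerCharSigns] :
    ((HomologicalComplex.single _ c n).obj V).eulerChar = (c.χ n : ℤ) * (Module.finrank K V : ℤ) := by
  rw [HomologicalComplex.eulerChar_eq_sum_finSet_of_finrankSupport_subset _ {n} (finrankSupport_single_subset V n),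
    Finset.sum_singleton, LinearEquiv.finrank_eq (HomologicalComplex.singleObjXSelf c n V).toLinearEquiv]

/-- **`χ_H((single n).obj V) = χ(n) · dim V`**. [cite: Lang2002, XX §3] -/
theorem homologyEulerChar_single [c.EulerCharSigns] :
    ((HomologicalComplex.single _ c n).obj V).homologyEulerChar = (c.χ n : ℤ) * (Module.finrank K V : ℤ) := by
  rw [HomologicalComplex.homologyEulerChar_eq_sum_finSet_of_finrankSupport_subset _ {n}
      (finrankSupport_single_homology_subset V n),
    Finset.sum_singleton, LinearEquiv.finrank_eq (HomologicalComplex.singleObjHomologySelfIso c n V).toLinearEquiv]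

end Single

/-! ### Binary biproducts -/

section Biprod

variable (C D : HomologicalComplex (ModuleCat.{v} K) c)

/-- The split short exact sequence `C ⟶ C ⊞ D ⟶ D` of complexes. [cite: Lang2002, XX §3] -/
theorem shortExact_biprod :
    (ShortComplex.mk (biprod.inl : C ⟶ C ⊞ D) (biprod.snd : C ⊞ D ⟶ D) (by simp)).ShortExact :=
  (ShortComplex.Splitting.ofHasBinaryBiproduct C D).shortExact

/-- **`χ(C ⊞ D) = χ(C) + χ(D)`** for Mathlib's `HomologicalComplex.eulerChar`, when `C`, `D` are degreewise
finite-dimensional with finitely many non-zero terms. [cite: Lang2002, XX §3] -/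
theorem eulerChar_biprod [c.EulerCharSigns] [∀ i, Module.Finite K (C.X i)] [∀ i, Module.Finite K (D.X i)]
    (hC : (GradedObject.finrankSupport C.X).Finite) (hD : (GradedObject.finrankSupport D.X).Finite) :
    (C ⊞ D).eulerChar = C.eulerChar + D.eulerChar := by
  have h := EulerCharShortExact.eulerChar_X₂_eq_add (shortExact_biprod C D) hC hD
  exact h

/-- **`χ_H(C ⊞ D) = χ_H(C) + χ_H(D)`** for Mathlib's `HomologicalComplex.homologyEulerChar`, when the homology of `C`
and of `D` is finite-dimensional in each degree with finite support. [cite: Lang2002, XX §3] -/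
theorem homologyEulerChar_biprod [c.EulerCharSigns] [∀ i, Module.Finite K (C.homology i)]
    [∀ i, Module.Finite K (D.homology i)]
    (hC : (GradedObject.finrankSupport fun i => C.homology i).Finite)
    (hD : (GradedObject.finrankSupport fun i => D.homology i).Finite) :
    (C ⊞ D).homologyEulerChar = C.homologyEulerChar + D.homologyEulerChar := by
  -- elaborate without the expected type first (inferring `S` from the goal would unfold `C ⊞ D`)
  have h := EulerCharShortExact.homologyEulerChar_X₂_eq_add (shortExact_biprod C D) hC hD
  exact h

end Biprod

end Literature.Algebra.Homology.EulerCharSingleBiprod
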